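import Summits.BirchSwinnertonDyer.Rank1Residual.X2.NonsplitHalvesIntRigidity
import Summits.BirchSwinnertonDyer.Rank1Residual.X2.SplitHalvesOnTreeInt
import Summits.BirchSwinnertonDyer.Rank1Residual.X2.NonsplitBDPValueDisplayPNew
import Summits.BirchSwinnertonDyer.Rank1Residual.X11b.Three.StepLHalves
import HarnessLib

/-!
# Crux 4 `BSDpOnCellC` (stmt-BirchSwinnertonDyer-19034), line b1, stub `stub_c2` — the INTEGRALITY
# INEQUALITY the typed value half forces at every X2c Heegner datum: `1 ≤ ord_p log_{ω_E} P_K`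
# (cell `bsd-eis`, seat `bsd-eis-k5-c4` g6; the kernel side of `HOME/k5-c4-MEMO-4.md`)

HONEST FRAMING (cell `bsd-eis`, run/shared/lean/pub/bsd-eis/): theorems only; nothing booked; X2 stays
CONSTRUCTION-SHAPED; no label or count moves; BSD is not proved by any of this. This file CLOSES NOTHING:
it derives, in the kernel, a NECESSARY CONDITION of the registered stub `stub_c2` of skeleton b1 (v8.1,
owner `bsd-eis-cgshw`) — the value half c2♭ / c2s♭ of crux 4 at `p = 3` — so that the per-pair numerical
census of `k5-c4-MEMO-4` (kit j267066 over the 12 665 O9 pairs; bsd-eis-ky's j237574 over the 705 window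
pairs before it) is a CHEAPEST-FALSIFIER run against a kernel-certified consequence, not against a
reading.

THE INEQUALITY. At an X2c Heegner datum `(W, p, K, 𝔭, P)` the typed value statement
`X11b.R1.BDPValueAtOneIntAt W p e P Q a` says `Q(𝟙) = u·((1 − a·p⁻¹)·log_{ω_E} P)²` with `‖u‖ = 1` for a
♭-frame `Q ∈ 𝓞_{ℂ_p}⟦T⟧`. Since `Q(𝟙) = Q(0) ∈ 𝓞_{ℂ_p}` has norm `≤ 1` and `‖1 − a p⁻¹‖ = p` when
`p ∤ a` (`X11b.R1.norm_one_sub_div_eq`), `‖log_{ω_E} P‖ ≤ p⁻¹`, i.e. **`1 ≤ ord_p log_{ω_E} P =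
padicLogOrd W p e P`** (`one_le_padicLogOrd_of_bdpValueAtOneIntAt`, §1; `log_{ω_E} P ≠ 0` for `P` of
infinite order, `X11b.R1.logOmega_ne_zero`). At the datum of c2♭ (`X2.NonsplitBDPValueOnTreeInt`) /
c2s♭ (`X2.SplitBDPValueOnTreeInt`) a ♭-frame EXISTS by Hsieh 2014 Thm. 1 as typed
(`X2.exists_isBDPLFunctionInt_of_hsieh2014_of_classX2`) and `a = a_p(E) = ±1` at a multiplicative `p`
(`X11b.Three.lFunction_eq_one_or_eq_neg_one_of_isNewformOf`), so c2♭ resp. c2s♭ force the inequality at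
EVERY admissible datum (§2, §3); §4 states it from the REGISTERED signature of `stub_c2` (both conjuncts,
`p = 3`) verbatim. The same inequality at `p ≥ 5` is a consequence of the PUBLISHED inputs alone (the
value half is discharged there from `Castella2018Exceptional.thm210_thm211_bdpDisplay_pNew`, k5-c4 g2
p436961 / cgshw g9 p438196) — recorded in the memo, not re-derived here.

WHY IT IS A TEST. `ord_p log_{ω_E} P_K = ord_p n_K + ord_p log_{ω_E} G` (`P_K = n_K·G` mod torsion, `G` a
generator, `n_K` the Heegner index from Gross–Zagier) is computable per pair from Cremona's tables and
PARI with NO `p`-adic `L`-function; at a SPLIT `p` it is not automatic (`ord_p log_{ω_E} G = 1 − ord_p c_p`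
occurs) and holds only through `p ∣ n_K`, i.e. through the Eisenstein torsion/Tamagawa bookkeeping. A
single pair with `ord_p log_{ω_E} P_K ≤ 0` would make {Hsieh (W2) as typed, `stub_c2` (p = 3) resp. the
typed cas-split input (p ≥ 5), Gross–Zagier, BSD-analytic Ш} jointly inconsistent at that datum.

References: [Castella2018] Thm. 3.2 (arXiv:1704.06608 p. 9); [Castella2018Exceptional] Thms. 2.10–2.11;
[Hsieh2014] Thm. 1; [SilvermanAEC2009] IV.6.4, VII.2.2 (formal logarithm); [GrossZagier1986] I.6.3.
-/

set_option autoImplicit false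
set_option linter.dupNamespace false

noncomputable section

open scoped Classical MatrixGroups ModularForm

open CongruenceSubgroup WeierstrassCurve NumberField IsDedekindDomain Field PowerSeries
  Literature.NumberTheory.EllipticCurves Literature.NumberTheory.EllipticCurves.GreenbergSelmer
  Literature.NumberTheory.EllipticCurves.ModularForms
  Literature.NumberTheory.EllipticCurves.Rank1Residual
  Literature.NumberTheory.EllipticCurves.Rank1Residual.Typed
  Literature.NumberTheory.GaloisRepresentations Literature.NumberTheory.GaloisCohomology
  Literature.NumberTheory.Automorphic
  Summit.BirchSwinnertonDyer.Rank1Residual.X11b.AcSelmer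
  Summit.BirchSwinnertonDyer.Rank1Residual.X11b.Halves
  Summit.BirchSwinnertonDyer.Rank1Residual.X11b
  Summit.BirchSwinnertonDyer.Rank1Residual.X2

namespace Summit.BirchSwinnertonDyer.BirchSwinnertonDyer.Theorems.ValueIntegrality

/-! ### §1 Pointwise: a value statement for an `𝓞_{ℂ_p}`-frame forces `ord_p log_{ω_E} P ≥ 1` -/

section Pointwise

variable {K : Type} [Field K] [NumberField K] (W : WeierstrassCurve ℚ) [W.IsElliptic]
  [W.IsGloballyMinimal] (p : ℕ) [Fact p.Prime] (ι : K →+* ℚ_[p]) (P : (W.baseChange K).toAffine.Point)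

/-- `±1` is not divisible by a prime. [folklore] -/
theorem not_natCast_dvd_of_eq_one_or_eq_neg_one {a : ℤ} (ha : a = 1 ∨ a = -1) : ¬ (p : ℤ) ∣ a := by
  have hp : p.Prime := Fact.out
  rintro hd
  have h1 : (p : ℤ) ∣ 1 := by
    rcases ha with h | h
    · rwa [h] at hd
    · rw [h] at hd; exact (dvd_neg.mp hd)
  have := Int.eq_one_of_dvd_one (by exact_mod_cast hp.pos.le) h1
  exact hp.one_lt.ne' (by exact_mod_cast this)

/-- **The integrality inequality.** If an `𝓞_{ℂ_p}`-integral frame `Q` carries the value statement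
`R1.BDPValueAtOneIntAt W p ι P Q a` (`Q(𝟙) = u·((1 − a p⁻¹)·log_{ω_E} P)²`, `‖u‖ = 1`) with `p ∤ a` and
`P` of infinite order, then `1 ≤ ord_p log_{ω_E} P` (`padicLogOrd W p ι P`): `‖Q(0)‖ ≤ 1` and
`‖1 − a p⁻¹‖ = p` give `‖log_{ω_E} P‖ ≤ p⁻¹`.
[cite: Castella2018, Thm. 3.2 (arXiv:1704.06608 p. 9) (shape of the value statement)]
[cite: SilvermanAEC2009, IV.6.4 and VII.2.2 (the formal logarithm)] -/
theorem one_le_padicLogOrd_of_bdpValueAtOneIntAt {Q : PowerSeries 𝓞_ℂ_[p]} {a : ℤ}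
    (ha : ¬ (p : ℤ) ∣ a) (hP : ¬ IsOfFinAddOrder P) (h : R1.BDPValueAtOneIntAt W p ι P Q a) :
    1 ≤ Rank1Residual.X11b.padicLogOrd W p ι P := by
  obtain ⟨u, hu, hQ⟩ := h
  have hp : p.Prime := Fact.out
  have hp1 : (1 : ℝ) < p := by exact_mod_cast hp.one_lt
  have hp0 : (0 : ℝ) < p := by positivity
  set x : ℚ_[p] := logOmega W p ι P with hx
  have hx0 : x ≠ 0 := R1.logOmega_ne_zero W p ι hP
  set y : ℚ_[p] := ((1 : ℚ_[p]) - (a : ℚ_[p]) * (p : ℚ_[p])⁻¹) * x with hy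
  -- `Q(0)` is the value at `𝟙`, an element of `𝓞_{ℂ_p}`
  have hQ0 : u * (algebraMap ℚ_[p] ℂ_[p] y) ^ 2 =
      ((PowerSeries.constantCoeff Q : 𝓞_ℂ_[p]) : ℂ_[p]) :=
    R1.intSeries_eq_constantCoeff_of_hasValueAt_zero p hQ
  have hle : ‖u * (algebraMap ℚ_[p] ℂ_[p] y) ^ 2‖ ≤ 1 := by
    rw [hQ0]; exact R1.norm_coe_padicComplexInt_le_one p _
  have hy2 : ‖y‖ ^ 2 ≤ 1 := by
    rwa [norm_mul, hu, one_mul, norm_pow, norm_algebraMap'] at hle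
  have hy1 : ‖y‖ ≤ 1 := by
    by_contra hgt
    rw [not_le] at hgt
    have : (1 : ℝ) < ‖y‖ ^ 2 := by nlinarith [norm_nonneg y]
    linarith
  -- `‖y‖ = p·‖x‖`, so `‖x‖ ≤ p⁻¹`
  have hyx : ‖y‖ = (p : ℝ) * ‖x‖ := by rw [hy, norm_mul, R1.norm_one_sub_div_eq p ha]
  have hxle : ‖x‖ ≤ (p : ℝ) ^ (-(1 : ℤ)) := by
    rw [zpow_neg, zpow_one]
    rw [hyx] at hy1
    rw [le_inv_comm₀ (norm_pos_iff.mpr hx0) hp0]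
    calc (p : ℝ) = (p : ℝ) * ‖x‖ * ‖x‖⁻¹ := by
          rw [mul_assoc, mul_inv_cancel₀ (norm_ne_zero_iff.mpr hx0), mul_one]
      _ ≤ 1 * ‖x‖⁻¹ := by gcongr
      _ = ‖x‖⁻¹ := one_mul _
  -- valuations
  have hv : (1 : ℤ) ≤ x.valuation := by
    rw [Padic.norm_eq_zpow_neg_valuation hx0, zpow_le_zpow_iff_right₀ hp1] at hxle
    omega
  rw [← valuation_logOmega hx0]
  exact hv

end Pointwise

/-! ### §2 At the X2 ∩ {non-split} Heegner datum: c2♭ forces the inequality (Hsieh supplies the frame) -/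

section Datum

variable {W : WeierstrassCurve ℚ} [W.IsElliptic] [W.IsGloballyMinimal] {p : ℕ} [Fact p.Prime]

/-- **c2♭ ⟹ `1 ≤ ord_p log_{ω_E} P_K` at every X2 ∩ {non-split} Heegner datum** (the binders of
`X2.NonsplitBDPValueOnTreeInt` VERBATIM up to the frame): Hsieh 2014 Thm. 1 as typed supplies an
`𝓞_{ℂ_p}`-frame at the datum (`X2.exists_isBDPLFunctionInt_of_hsieh2014_of_classX2`), c2♭ gives its
value at `𝟙`, `a_p(E) = ±1` at the multiplicative `p`, and §1 applies. The necessary condition tested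
per pair by kit j267066 / j237574 on the 3 052 + 103 + 8 non-split O9 cells (where it is automatic:
`[E(ℚ_p):E₁(ℚ_p)] = c_p·(p+1)` is prime to `p`).
[cite: Hsieh2014, Thm. 1 (arXiv:1112.1580 pp. 3–4)] [cite: Castella2018, Thm. 3.2 (arXiv:1704.06608 p. 9)] -/
theorem one_le_padicLogOrd_of_nonsplitBDPValueOnTreeInt
    (hH : hsieh2014_exists_anticyclotomicPAdicLFunction) (h : NonsplitBDPValueOnTreeInt W p)
    (N : ℕ) [NeZero N] (K : Type) [Field K] [NumberField K] (Dt : ModularParametrizationData W N)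
    (Hd : HeegnerDatum N (NumberField.discr K)) (ιK : K →+* ℂ) (P : (W.baseChange K).toAffine.Point)
    (hc : CellC W p) (hns : ¬ W.HasSplitMultiplicativeReductionAtPrime p) (hN : W.conductorNorm ℤ = N)
    (hK : IsImaginaryQuadratic K) (hd4 : NumberField.discr K < -4)
    (hHN : SatisfiesHeegnerHypothesis N K)
    (hLt : (W.quadraticTwist (NumberField.discr K : ℚ)).entireLFunction 1 ≠ 0)
    (hP : WeierstrassCurve.Affine.Point.map ιK.toRatAlgHom P = heegnerPointComplex Dt Hd)
    (hcM : ¬ (p : ℤ) ∣ Dt.c) (hPinf : ¬ IsOfFinAddOrder P)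
    (κ : ZpExtension K p) (hκ : κ.IsAnticyclotomic) (γ : Field.absoluteGaloisGroup K)
    [hγ : Fact (κ.IsTopGenerator γ)]
    (𝔭 : HeightOneSpectrum (𝓞 K)) (h𝔭 : ((p : ℕ) : 𝓞 K) ∈ 𝔭.asIdeal)
    (he : 𝔭.asIdeal.ramificationIdx (𝓞 ℚ) = 1) (hf : 𝔭.asIdeal.inertiaDeg (𝓞 ℚ) = 1)
    (f : CuspForm (CongruenceSubgroup.Gamma0 N) 2) (hfW : IsNewformOf W f)
    (ι' : PadicAlgCl p ≃+* ℂ)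
    (hι' : ∀ (w : InfinitePlace K) (k : 𝓞 K), k ∈ 𝔭.asIdeal ↔ ‖ι'.symm (w.embedding (k : K))‖ < 1) :
    1 ≤ Rank1Residual.X11b.padicLogOrd W p (embAt K p 𝔭 h𝔭 he hf) P := by
  obtain ⟨ΩK, Ωp, Q, hΩK, hΩp, hQ⟩ := exists_isBDPLFunctionInt_of_hsieh2014_of_classX2 W p hH ι' 𝔭 κ
    γ hfW hc.2 hN hK hHN h𝔭 hι' hκ hγ.out
  have hval := h N K Dt Hd ιK P hc hns hN hK hd4 hHN hLt hP hcM hPinf κ hκ γ 𝔭 h𝔭 he hf f hfW ι' hι'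
    ΩK Ωp Q hΩK hΩp hQ
  have ha : ¬ (p : ℤ) ∣ W.LFunction p := not_natCast_dvd_of_eq_one_or_eq_neg_one p
    (Three.lFunction_eq_one_or_eq_neg_one_of_isNewformOf W hfW hc.2.2.2)
  exact one_le_padicLogOrd_of_bdpValueAtOneIntAt W p _ P ha hPinf hval

/-! ### §3 At the X2 ∩ {split} Heegner datum: c2s♭ forces the inequality -/

/-- **c2s♭ ⟹ `1 ≤ ord_p log_{ω_E} P_K` at every X2 ∩ {split} Heegner datum** (the binders of
`X2.SplitBDPValueOnTreeInt` VERBATIM up to the frame; frame from Hsieh 2014 Thm. 1 as typed). At a SPLIT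
`p` the inequality is NOT automatic (`ord_p log_{ω_E} G = 1 − ord_p c_p` occurs for the generator `G`;
72 of 543 window split pairs have `ord_3 log_{ω_E} G = 0`) and is carried by `p ∣ n_K` — the tested
content of kit j267066 / j237574 on the 9 054 + 413 + 35 split O9 cells.
[cite: Castella2018Exceptional, Thm. 2.11 (arXiv:1507.04260 p. 14) (value display at a_p = +1, p ≥ 5)]
[cite: Hsieh2014, Thm. 1 (arXiv:1112.1580 pp. 3–4)] -/
theorem one_le_padicLogOrd_of_splitBDPValueOnTreeInt
    (hH : hsieh2014_exists_anticyclotomicPAdicLFunction) (h : SplitBDPValueOnTreeInt W p)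
    (N : ℕ) [NeZero N] (K : Type) [Field K] [NumberField K] (Dt : ModularParametrizationData W N)
    (Hd : HeegnerDatum N (NumberField.discr K)) (ιK : K →+* ℂ) (P : (W.baseChange K).toAffine.Point)
    (hc : CellC W p) (hs : W.HasSplitMultiplicativeReductionAtPrime p) (hN : W.conductorNorm ℤ = N)
    (hK : IsImaginaryQuadratic K) (hd4 : NumberField.discr K < -4)
    (hHN : SatisfiesHeegnerHypothesis N K)
    (hLt : (W.quadraticTwist (NumberField.discr K : ℚ)).entireLFunction 1 ≠ 0)
    (hP : WeierstrassCurve.Affine.Point.map ιK.toRatAlgHom P = heegnerPointComplex Dt Hd)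
    (hcM : ¬ (p : ℤ) ∣ Dt.c) (hPinf : ¬ IsOfFinAddOrder P)
    (κ : ZpExtension K p) (hκ : κ.IsAnticyclotomic) (γ : Field.absoluteGaloisGroup K)
    [hγ : Fact (κ.IsTopGenerator γ)]
    (𝔭 : HeightOneSpectrum (𝓞 K)) (h𝔭 : ((p : ℕ) : 𝓞 K) ∈ 𝔭.asIdeal)
    (he : 𝔭.asIdeal.ramificationIdx (𝓞 ℚ) = 1) (hf : 𝔭.asIdeal.inertiaDeg (𝓞 ℚ) = 1)
    (f : CuspForm (CongruenceSubgroup.Gamma0 N) 2) (hfW : IsNewformOf W f)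
    (ι' : PadicAlgCl p ≃+* ℂ)
    (hι' : ∀ (w : InfinitePlace K) (k : 𝓞 K), k ∈ 𝔭.asIdeal ↔ ‖ι'.symm (w.embedding (k : K))‖ < 1) :
    1 ≤ Rank1Residual.X11b.padicLogOrd W p (embAt K p 𝔭 h𝔭 he hf) P := by
  obtain ⟨ΩK, Ωp, Q, hΩK, hΩp, hQ⟩ := exists_isBDPLFunctionInt_of_hsieh2014_of_classX2 W p hH ι' 𝔭 κ
    γ hfW hc.2 hN hK hHN h𝔭 hι' hκ hγ.out
  have hval := h N K Dt Hd ιK P hc hs hN hK hd4 hHN hLt hP hcM hPinf κ hκ γ 𝔭 h𝔭 he hf f hfW ι' hι'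
    ΩK Ωp Q hΩK hΩp hQ
  have ha : ¬ (p : ℤ) ∣ W.LFunction p := not_natCast_dvd_of_eq_one_or_eq_neg_one p
    (Three.lFunction_eq_one_or_eq_neg_one_of_isNewformOf W hfW hc.2.2.2)
  exact one_le_padicLogOrd_of_bdpValueAtOneIntAt W p _ P ha hPinf hval

end Datum

/-! ### §4 From the REGISTERED signature of `stub_c2` (skeleton b1 v8.1, both conjuncts, `p = 3`) -/

section Stub

/-- **`stub_c2` ⟹ the integrality inequality at `p = 3`, either sign.** The hypothesis `h2` is the
registered signature of `stub_c2` of crux 4 `BSDpOnCellC` (line b1 v8.1, 99d6acbce2943445) VERBATIM; the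
conclusion is `1 ≤ ord_3 log_{ω_E} P_K` at EVERY X2c Heegner datum at `p = 3` (sign-free binder list),
given Hsieh 2014 Thm. 1 as typed — the statement whose per-pair instances kit j267066 (12 106 O9 cells
at `p = 3`) computes. A refutation of one instance (an instrument-certified datum with
`ord_3 log_{ω_E} P_K ≤ 0`) would refute `stub_c2` modulo the PUBLISHED Hsieh input.
[cite: Hsieh2014, Thm. 1 (arXiv:1112.1580 pp. 3–4)]
[cite: Castella2018Exceptional, Thm. 2.10 and 2.11 (what is printed at p ≥ 5; nothing at p = 3)] -/
theorem one_le_padicLogOrd_at_three_of_stub_c2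
    (hH : hsieh2014_exists_anticyclotomicPAdicLFunction)
    (h2 : (∀ (W : WeierstrassCurve ℚ) [W.IsElliptic] [W.IsGloballyMinimal] (p : ℕ) [Fact p.Prime],
        p = 3 → CellC W p → ¬ W.HasSplitMultiplicativeReductionAtPrime p →
          NonsplitBDPValueOnTreeInt W p) ∧
      (∀ (W : WeierstrassCurve ℚ) [W.IsElliptic] [W.IsGloballyMinimal] (p : ℕ) [Fact p.Prime],
        p = 3 → CellC W p → W.HasSplitMultiplicativeReductionAtPrime p → SplitBDPValueOnTreeInt W p))
    (W : WeierstrassCurve ℚ) [W.IsElliptic] [W.IsGloballyMinimal] (p : ℕ) [Fact p.Prime] (hp3 : p = 3)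
    (N : ℕ) [NeZero N] (K : Type) [Field K] [NumberField K] (Dt : ModularParametrizationData W N)
    (Hd : HeegnerDatum N (NumberField.discr K)) (ιK : K →+* ℂ) (P : (W.baseChange K).toAffine.Point)
    (hc : CellC W p) (hN : W.conductorNorm ℤ = N)
    (hK : IsImaginaryQuadratic K) (hd4 : NumberField.discr K < -4)
    (hHN : SatisfiesHeegnerHypothesis N K)
    (hLt : (W.quadraticTwist (NumberField.discr K : ℚ)).entireLFunction 1 ≠ 0)
    (hP : WeierstrassCurve.Affine.Point.map ιK.toRatAlgHom P = heegnerPointComplex Dt Hd)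
    (hcM : ¬ (p : ℤ) ∣ Dt.c) (hPinf : ¬ IsOfFinAddOrder P)
    (κ : ZpExtension K p) (hκ : κ.IsAnticyclotomic) (γ : Field.absoluteGaloisGroup K)
    [Fact (κ.IsTopGenerator γ)]
    (𝔭 : HeightOneSpectrum (𝓞 K)) (h𝔭 : ((p : ℕ) : 𝓞 K) ∈ 𝔭.asIdeal)
    (he : 𝔭.asIdeal.ramificationIdx (𝓞 ℚ) = 1) (hf : 𝔭.asIdeal.inertiaDeg (𝓞 ℚ) = 1)
    (f : CuspForm (CongruenceSubgroup.Gamma0 N) 2) (hfW : IsNewformOf W f)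
    (ι' : PadicAlgCl p ≃+* ℂ)
    (hι' : ∀ (w : InfinitePlace K) (k : 𝓞 K), k ∈ 𝔭.asIdeal ↔ ‖ι'.symm (w.embedding (k : K))‖ < 1) :
    1 ≤ Rank1Residual.X11b.padicLogOrd W p (embAt K p 𝔭 h𝔭 he hf) P := by
  by_cases hs : W.HasSplitMultiplicativeReductionAtPrime p
  · exact one_le_padicLogOrd_of_splitBDPValueOnTreeInt hH (h2.2 W p hp3 hc hs) N K Dt Hd ιK P hc hs hN
      hK hd4 hHN hLt hP hcM hPinf κ hκ γ 𝔭 h𝔭 he hf f hfW ι' hι'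
  · exact one_le_padicLogOrd_of_nonsplitBDPValueOnTreeInt hH (h2.1 W p hp3 hc hs) N K Dt Hd ιK P hc hs
      hN hK hd4 hHN hLt hP hcM hPinf κ hκ γ 𝔭 h𝔭 he hf f hfW ι' hι'

end Stub

/-! ### §5 (append, g6) At `p ≥ 5` the inequality follows from the PUBLISHED inputs alone -/

section PNew

/-- **`p ≥ 5`: `1 ≤ ord_p log_{ω_E} P_K` at every X2 Heegner datum with odd `d_K`, from PUBLISHED facts
ONLY** — Hsieh 2014 Thm. 1 (`hH`, the `𝓞_{ℂ_p}`-frame `Q` at the datum) and Castella JIMJ 17 Thms.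
2.10–2.11 in BDP 2013's display (`hCS`, `thm210_thm211_bdpDisplay_pNew`, `p ≥ 5`, `p ‖ N`, `a_p`
symbolic — EITHER sign, no image hypothesis): the continuity display of k5-c4 g2's
`X2.continuousDisplay_pNew_of_bdpDisplay` (p436452) transfers to `Q(𝟙)` by the X11b cell's one-sided
value rigidity (`Rank1Residual.X11b.intSeries_constantCoeff_eq_of_isBDPLFunctionInt_of_continuousValues`) exactly as
inside `X2.bsdp_of_cellC_of_not_split_of_manin_of_pNewValue_of_imcInt_of_partner` (p436961), and §1
applies. So on the 516 + 43 O9 cells at `p ∈ {5, 7}` the census of kit j267066 tests the mutual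
consistency of TYPED PUBLISHED inputs (with Gross–Zagier and BSD-analytic Ш), not a conjecture. Rank is
not used: any `P` of infinite order that is the Heegner point of the datum.
[cite: Castella2018Exceptional, Thm. 2.10 and Thm. 2.11 (arXiv:1507.04260 pp. 13–14)]
[cite: Hsieh2014, Thm. 1 (arXiv:1112.1580 pp. 3–4)] [cite: Castella2018, Thm. 3.2 with (3.2)–(3.3) (arXiv:1704.06608 p. 9)] -/
theorem one_le_padicLogOrd_of_bdpDisplay_pNew_of_five_le
    (hH : hsieh2014_exists_anticyclotomicPAdicLFunction) (hCS : Castella2018Exceptional.thm210_thm211_bdpDisplay_pNew)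
    {p : ℕ} [Fact p.Prime] (W : WeierstrassCurve ℚ) [W.IsElliptic] [W.IsGloballyMinimal]
    (K : Type) [Field K] [NumberField K] {N : ℕ} [NeZero N]
    (Dt : ModularParametrizationData W N) (Hd : HeegnerDatum N (NumberField.discr K))
    (w : InfinitePlace K) (P : (W.baseChange K).toAffine.Point)
    (hp5 : 5 ≤ p) (hX : ClassX2 W p) (hN : W.conductorNorm ℤ = N)
    (hK : IsImaginaryQuadratic K) (hodd : Odd (NumberField.discr K))
    (hHN : SatisfiesHeegnerHypothesis N K)
    (hP : WeierstrassCurve.Affine.Point.map w.embedding.toRatAlgHom P = heegnerPointComplex Dt Hd)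
    (hcM : ¬ (p : ℤ) ∣ Dt.c) (hPinf : ¬ IsOfFinAddOrder P)
    (κ : ZpExtension K p) (hκ : κ.IsAnticyclotomic) (γ : Field.absoluteGaloisGroup K)
    (hγ : κ.IsTopGenerator γ)
    (𝔭 : HeightOneSpectrum (𝓞 K)) (h𝔭 : ((p : ℕ) : 𝓞 K) ∈ 𝔭.asIdeal)
    (he : 𝔭.asIdeal.ramificationIdx (𝓞 ℚ) = 1) (hf : 𝔭.asIdeal.inertiaDeg (𝓞 ℚ) = 1)
    (ι' : PadicAlgCl p ≃+* ℂ)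
    (hι' : ∀ (w' : InfinitePlace K) (k : 𝓞 K), k ∈ 𝔭.asIdeal ↔ ‖ι'.symm (w'.embedding (k : K))‖ < 1) :
    1 ≤ Rank1Residual.X11b.padicLogOrd W p (embAt K p 𝔭 h𝔭 he hf) P := by
  have hp : p.Prime := Fact.out
  obtain ⟨hp2, hred, hmult⟩ := hX
  have hpN : p ∣ N := hN ▸ Rank1Residual.X11b.dvd_conductorNorm_of_mult (W := W) hmult
  have hp2N : ¬ p ^ 2 ∣ N := hN ▸ Rank1Residual.X2.not_sq_dvd_conductorNorm_of_mult W p hmult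
  -- Hsieh's `𝓞_{ℂ_p}`-frame at the datum
  obtain ⟨ΩK', Ωp', Q, hΩK', hΩp', hQ⟩ := exists_isBDPLFunctionInt_of_hsieh2014_of_classX2 W p hH ι' 𝔭
    κ γ Dt.isNewformOf ⟨hp2, hred, hmult⟩ hN hK hHN h𝔭 hι' hκ hγ
  have hΩp0' : Ωp' ≠ 0 := fun h0 ↦ by rw [h0, norm_zero] at hΩp'; exact zero_ne_one hΩp'
  -- the continuity display from print at the datum
  have hemb : ∀ k : 𝓞 K, k ∈ 𝔭.asIdeal ↔ ‖embAt K p 𝔭 h𝔭 he hf (k : K)‖ < 1 :=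
    mem_asIdeal_iff_norm_embAt_lt_one 𝔭 h𝔭 he hf
  obtain ⟨ΩK₀, Ωp₀, u₀, hΩK₀, hΩp₀, hu₀, hcont⟩ := continuousDisplay_pNew_of_bdpDisplay hCS ι' W K 𝔭 κ γ
    Dt Hd w (embAt K p 𝔭 h𝔭 he hf) P hp5 hN hpN hp2N hK hodd (hHN p hp hpN) h𝔭 hι' hHN hκ hγ hcM hP hemb
  -- the target is non-zero
  have ha : ¬ (p : ℤ) ∣ W.LFunction p := Rank1Residual.X11b.R1.not_dvd_lFunction_of_mult Dt.isNewformOf hmult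
  have hX0 : algebraMap ℚ_[p] ℂ_[p] (((1 : ℚ_[p]) - ((W.LFunction p : ℤ) : ℚ_[p]) * (p : ℚ_[p])⁻¹) *
      Castella2018.padicLogOmega W p (embAt K p 𝔭 h𝔭 he hf) P) ≠ 0 := by
    rw [map_ne_zero_iff _ (algebraMap ℚ_[p] ℂ_[p]).injective]
    refine mul_ne_zero ?_ ?_
    · intro h0
      have h := Rank1Residual.X11b.R1.norm_one_sub_div_eq p ha
      rw [h0, norm_zero] at h
      have hp0 : (0 : ℝ) < p := by exact_mod_cast hp.pos
      exact absurd h (ne_of_lt hp0)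
    · rw [← Rank1Residual.X11b.R1.logOmega_eq_padicLogOmega]
      exact Rank1Residual.X11b.R1.logOmega_ne_zero W p _ hPinf
  have hu₀0 : u₀ ≠ 0 := fun h0 ↦ by rw [h0, norm_zero] at hu₀; exact zero_ne_one hu₀
  have hc0 : u₀ * (algebraMap ℚ_[p] ℂ_[p] (((1 : ℚ_[p]) - ((W.LFunction p : ℤ) : ℚ_[p]) *
      (p : ℚ_[p])⁻¹) * Castella2018.padicLogOmega W p (embAt K p 𝔭 h𝔭 he hf) P)) ^ 2 ≠ 0 :=
    mul_ne_zero hu₀0 (pow_ne_zero _ hX0)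
  -- one-sided value rigidity: the display's limit IS `Q(0)`
  have heq := Rank1Residual.X11b.intSeries_constantCoeff_eq_of_isBDPLFunctionInt_of_continuousValues hp2 hK hκ hγ
    hΩK₀ hΩK' hΩp₀ hΩp0' hcont hc0 hQ
  have h2Q : R1.BDPValueAtOneIntAt W p (embAt K p 𝔭 h𝔭 he hf) P Q (W.LFunction p) := by
    refine ⟨u₀, hu₀, ?_⟩
    rw [Rank1Residual.X11b.R1.logOmega_eq_padicLogOmega, ← heq]
    exact Rank1Residual.X11b.R1.intSeries_hasValueAt_zero p Q
  exact one_le_padicLogOrd_of_bdpValueAtOneIntAt W p _ P ha hPinf h2Q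

end PNew

end Summit.BirchSwinnertonDyer.BirchSwinnertonDyer.Theorems.ValueIntegrality

end
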